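import Summits.CriticalPhenomena.CardyFormulaZ2.Theses.CardyFlipRusso

/-!
# Crux `CoveringLeg` (stmt-CriticalPhenomena-6435) — line `Sketch` (card `marginal-is-conformal`)

Lead's skeleton (reconstructed from the card; the planner's `Sketch.lean` evidence file is not
mounted in the prover jail, its declarations are described verbatim in
`Cruxes/CoveringLeg/Ideas/marginal-is-conformal.md`, "First lemma" / "Transfer").

Composition (sorry-free): `bond = site − (site − bond)`; if the deviation `site_R − bond_R` has a
limit that is a function `D` of the cross-ratio for every conformal rectangle `R`
(`stub_deviation`), then, under the crux hypothesis (Cardy for site-`G_s`), the crude bond-`ℤ²`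
crossing probabilities converge to `F − D` of the cross-ratio; crude Cardy rigidity
(`stub_rigidity`) forces `F − D = F` on `(0, 1)`, where every cross-ratio of a uniformizing datum
lives (`crossRatio_mem_Ioo_of_isUniformizing`), hence Cardy for crude bond-`ℤ²`, i.e. the
consequent of `CoveringLeg`.

Lead's structural check (proved below, `deviation_iff_crudeConformalLimit`,
`coveringLeg_of_crudeConformalLimit_of_rigidity`): under the crux hypothesis `stub_deviation` is
EQUIVALENT to crude `X_U` ("crude bond-ℤ² crossing probabilities have some cross-ratio limit",
the crude twin of `CardyUniqueLimit.CardyUniqueLimitThesis`, stmt-CriticalPhenomena-0745), and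
crude `X_U` + `stub_rigidity` give `CoveringLeg` WITHOUT using its hypothesis.
-/

namespace Summit.CriticalPhenomena.CardyFormulaZ2.Cruxes.CoveringLeg.Sketch

open Filter Set Topology
open Literature.Probability.RandomPlanarGeometry Literature.Probability.Percolation
open Literature.Probability.LatticeModels

noncomputable section

/-! ### The crux's objects (the `let`s of `CardyFlipRusso.CoveringLeg`, named) -/

/-- The embedding of the centred square lattice `G_s = ℤ² ⊔ (ℤ² + (½, ½))` into `ℂ`
(the `let z` of `CardyFlipRusso.CoveringLeg`). -/
def zEmb : (ℤ × ℤ) ⊕ (ℤ × ℤ) → ℂ :=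
  Sum.elim (fun x ↦ (x.1 : ℂ) + (x.2 : ℂ) * Complex.I)
    (fun f ↦ ((f.1 : ℂ) + 1 / 2) + ((f.2 : ℂ) + 1 / 2) * Complex.I)

/-- The centred square lattice graph `G_s` (ℤ²-edges of length `1` and centre-to-corner edges of
length `√2/2 < 1`; the `let G` of `CardyFlipRusso.CoveringLeg`). -/
def gS : SimpleGraph ((ℤ × ℤ) ⊕ (ℤ × ℤ)) :=
  SimpleGraph.fromRel (fun a b ↦ a.isLeft = true ∧
    ((b.isLeft = true ∧ dist (zEmb a) (zEmb b) = 1) ∨ (b.isRight = true ∧ dist (zEmb a) (zEmb b) < 1)))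

/-- Crude site crossing probability of the conformal rectangle `R` at mesh `δ` for site
percolation at `1/2` on `G_s` (the antecedent's family in `CoveringLeg`). -/
def siteProb (R : ConformalRectangle) (δ : ℝ) : ℝ :=
  (sitePercolation ((ℤ × ℤ) ⊕ (ℤ × ℤ)) half).real
    {ω | ∃ u v, Metric.infDist ((δ : ℂ) * zEmb u) (R.arc 0) ≤ 2 * δ ∧
      Metric.infDist ((δ : ℂ) * zEmb v) (R.arc 2) ≤ 2 * δ ∧
      ω ∈ siteConnIn gS {y | (δ : ℂ) * zEmb y ∈ R.carrier} u v}

/-- Crude bond crossing probability of `R` at mesh `δ` for bond percolation on `ℤ²` at `1/2`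
(`embDomainCrossing`, the consequent's family in `CoveringLeg`). -/
def bondProb (R : ConformalRectangle) (δ : ℝ) : ℝ :=
  (bondPercolation (zdGraph 2) half).real
    (embDomainCrossing squareLatticeEmbedding.z R.carrier δ (R.arc 0) (R.arc 2))

/-- The antecedent of `CoveringLeg`: Cardy's formula for crude site-`G_s` crossings. -/
def SiteCardy : Prop :=
  ∀ R : ConformalRectangle, R.HasCrossingLimit (siteProb R) cardyFunction

/-- The consequent of `CoveringLeg`: Cardy's formula for crude bond-`ℤ²` crossings. -/
def BondCardy : Prop :=
  ∀ R : ConformalRectangle, R.HasCrossingLimit (bondProb R) cardyFunction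

/-- `CoveringLeg` is literally `SiteCardy → BondCardy` (the `let`s zeta-reduce). -/
theorem coveringLeg_iff : Theses.CardyFlipRusso.CoveringLeg ↔ (SiteCardy → BondCardy) :=
  Iff.rfl

/-! ### The line's two statements -/

/-- Card (a): the deviation `site_R − bond_R` has a limit which is a function of the cross-ratio. -/
def DeviationHasConformalLimit : Prop :=
  ∃ D : ℝ → ℝ, ∀ R : ConformalRectangle,
    R.HasCrossingLimit (fun δ ↦ siteProb R δ - bondProb R δ) D

/-- Card (b): crude Cardy rigidity on `ℤ²` (crude twin of `CardyUniqueLimit.CardyRigidity`). -/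
def CrudeCardyRigidity : Prop :=
  ∀ f : ℝ → ℝ, (∀ R : ConformalRectangle, R.HasCrossingLimit (bondProb R) f) →
    EqOn f cardyFunction (Ioo 0 1)

/-- Crude `X_U`: crude bond-`ℤ²` crossing probabilities have SOME cross-ratio limit
(crude twin of `CardyUniqueLimit.CardyUniqueLimitThesis`, stmt-CriticalPhenomena-0745). -/
def CrudeConformalLimit : Prop :=
  ∃ f : ℝ → ℝ, ∀ R : ConformalRectangle, R.HasCrossingLimit (bondProb R) f

/-! ### Stubs (registered; tree vocabulary only) -/

/-- STUB (lead): the deviation has a cross-ratio limit — `DeviationHasConformalLimit` unfolded. -/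
theorem stub_deviation :
    (let z : (ℤ × ℤ) ⊕ (ℤ × ℤ) → ℂ := Sum.elim (fun x ↦ (x.1 : ℂ) + (x.2 : ℂ) * Complex.I)
      (fun f ↦ ((f.1 : ℂ) + 1 / 2) + ((f.2 : ℂ) + 1 / 2) * Complex.I)
    let G : SimpleGraph ((ℤ × ℤ) ⊕ (ℤ × ℤ)) := SimpleGraph.fromRel (fun a b ↦ a.isLeft = true ∧
      ((b.isLeft = true ∧ dist (z a) (z b) = 1) ∨ (b.isRight = true ∧ dist (z a) (z b) < 1)))
    ∃ D : ℝ → ℝ, ∀ R : Literature.Probability.RandomPlanarGeometry.ConformalRectangle,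
      R.HasCrossingLimit (fun δ ↦
        (Literature.Probability.Percolation.sitePercolation ((ℤ × ℤ) ⊕ (ℤ × ℤ))
            Literature.Probability.Percolation.half).real
          {ω | ∃ u v, Metric.infDist ((δ : ℂ) * z u) (R.arc 0) ≤ 2 * δ ∧
            Metric.infDist ((δ : ℂ) * z v) (R.arc 2) ≤ 2 * δ ∧
            ω ∈ Literature.Probability.Percolation.siteConnIn G {y | (δ : ℂ) * z y ∈ R.carrier} u v}
        - (Literature.Probability.Percolation.bondPercolation
            (Literature.Probability.LatticeModels.zdGraph 2) Literature.Probability.Percolation.half).real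
          (Literature.Probability.Percolation.embDomainCrossing
            Literature.Probability.LatticeModels.squareLatticeEmbedding.z R.carrier δ (R.arc 0) (R.arc 2)))
        D) := by
  sorry

/-- STUB (delegated): crude Cardy rigidity on `ℤ²` — `CrudeCardyRigidity` unfolded. -/
theorem stub_rigidity :
    ∀ f : ℝ → ℝ, (∀ R : Literature.Probability.RandomPlanarGeometry.ConformalRectangle,
      R.HasCrossingLimit (fun δ ↦ (Literature.Probability.Percolation.bondPercolation
          (Literature.Probability.LatticeModels.zdGraph 2) Literature.Probability.Percolation.half).real
        (Literature.Probability.Percolation.embDomainCrossing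
          Literature.Probability.LatticeModels.squareLatticeEmbedding.z R.carrier δ (R.arc 0) (R.arc 2))) f) →
      Set.EqOn f Literature.Probability.RandomPlanarGeometry.cardyFunction (Set.Ioo 0 1) := by
  sorry

/-! ### Glue (sorry-free) -/

/-- Crude `X_U` + crude rigidity ⇒ Cardy for crude bond-`ℤ²` (the `closes` argument of route
CardyUniqueLimit, crude form). -/
theorem bondCardy_of_crudeConformalLimit_of_rigidity (hX : CrudeConformalLimit)
    (hRig : CrudeCardyRigidity) : BondCardy := by
  obtain ⟨f, hf⟩ := hX
  intro R φ x hφ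
  have hη : crossRatio x ∈ Ioo (0 : ℝ) 1 :=
    ConformalRectangle.crossRatio_mem_Ioo_of_isUniformizing hφ
  rw [← hRig f hf hη]
  exact hf R φ x hφ

/-- Under the crux hypothesis, a cross-ratio limit of the deviation gives crude `X_U`
(`bond = site − (site − bond)`, `Tendsto.sub`). -/
theorem crudeConformalLimit_of_siteCardy_of_deviation (hA : SiteCardy)
    (hD : DeviationHasConformalLimit) : CrudeConformalLimit := by
  obtain ⟨D, hD⟩ := hD
  refine ⟨fun η ↦ cardyFunction η - D η, fun R φ x hφ ↦ ?_⟩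
  have h := (hA R φ x hφ).sub (hD R φ x hφ)
  have hfun : (fun δ ↦ siteProb R δ - (siteProb R δ - bondProb R δ)) = bondProb R := by
    funext δ
    ring
  rw [hfun] at h
  exact h

/-- Conversely, under the crux hypothesis crude `X_U` gives a cross-ratio limit of the deviation. -/
theorem deviation_of_siteCardy_of_crudeConformalLimit (hA : SiteCardy)
    (hX : CrudeConformalLimit) : DeviationHasConformalLimit := by
  obtain ⟨f, hf⟩ := hX
  exact ⟨fun η ↦ cardyFunction η - f η, fun R φ x hφ ↦ (hA R φ x hφ).sub (hf R φ x hφ)⟩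

/-- STRUCTURAL CHECK 1: under the crux hypothesis the lead's stub is exactly crude `X_U`. -/
theorem deviation_iff_crudeConformalLimit (hA : SiteCardy) :
    DeviationHasConformalLimit ↔ CrudeConformalLimit :=
  ⟨crudeConformalLimit_of_siteCardy_of_deviation hA,
    deviation_of_siteCardy_of_crudeConformalLimit hA⟩

/-- The card's transfer: (a) + (b) ⇒ `CoveringLeg`. -/
theorem coveringLeg_of_deviation_and_rigidity (hD : DeviationHasConformalLimit)
    (hRig : CrudeCardyRigidity) : Theses.CardyFlipRusso.CoveringLeg :=
  coveringLeg_iff.2 fun hA ↦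
    bondCardy_of_crudeConformalLimit_of_rigidity (crudeConformalLimit_of_siteCardy_of_deviation hA hD)
      hRig

/-- STRUCTURAL CHECK 2 (hypothesis idle): crude `X_U` + (b) ⇒ `CoveringLeg` with the antecedent
unused. -/
theorem coveringLeg_of_crudeConformalLimit_of_rigidity (hX : CrudeConformalLimit)
    (hRig : CrudeCardyRigidity) : Theses.CardyFlipRusso.CoveringLeg :=
  coveringLeg_iff.2 fun _ ↦ bondCardy_of_crudeConformalLimit_of_rigidity hX hRig

/-- COMPOSITION: the stubs close the crux by name. -/
theorem CoveringLeg_of : Theses.CardyFlipRusso.CoveringLeg :=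
  coveringLeg_of_deviation_and_rigidity stub_deviation stub_rigidity

end

end Summit.CriticalPhenomena.CardyFormulaZ2.Cruxes.CoveringLeg.Sketch
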